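import Literature.AnabelianGeometry.SemiGraphs.PreimageComponentsIncidence
import Literature.AnabelianGeometry.SemiGraphs.FiniteEtaleCoveringConnectedProofs
import HarnessLib

/-!
# The `B(𝒢_ℍ)`-sub-object attached to a component of the preimage of `ℍ` ([SemiAnbd] §2, p. 30)

Mochizuki, *Semi-graphs of anabelioids*, Publ. RIMS **42** (2006), §2, proof of Corollary 2.7 (i),
p. 30: for the finite étale covering `𝒢′ → 𝒢` attached to `A ∈ B(𝒢)` and a connected sub-semi-graph
`ℍ`, the components `ℋ″` of the restriction `ℋ′ → ℍ` are themselves finite étale coverings of `𝒢_ℍ`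
— i.e. they correspond to sub-objects of `A|_ℍ ∈ B(𝒢_ℍ)` [cite: MochizukiSemiAnbd2006, Cor. 2.7(i) p.30].

PROOF-ONLY (abc-iut cell, L3 row «D3a», brick M2, abc-iut-L6-t17; interface posted 2026-08-26):
`exists_preimageComponentObject` — for the LOCAL data `(cV, cE, position clause)` of
`Hom.IsFiniteEtaleCoveringOf φ A`, a PROPER base, a sub-GRAPH `ℍ` and a preimage component `K` of
`φ⁻¹(ℍ)`: there is a sub-object `m : Z_K ↪ A|_ℍ` of `B(𝒢_ℍ)` whose fibre-image at a vertex `w ∈ ℍ`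
(resp. an edge `e ∈ ℍ`) is the union of the fibre-images of the components `cV w″`, `w″ ∈ K` over `w`
(resp. `cE e″`, `e″ ∈ K` over `e`).  The construction is abc-iut-L6-d5's (D8) construction
(`FiniteEtaleCoveringConnectedProofs.lean`: coproduct of the selected components, gluing by the KEY
identity "components of `T_e` under `ψ_b(b^* P)`, `P` selected over `w` = selected components of
`T_e`"), restricted to `ℍ`; the KEY identity now uses the incidence closure of `K`
(`PreimageComponentsIncidence.lean`).  Brick M3 (abc-iut-w5-d041) proves `Z_K` connected and reads
off the bijection components ↔ `Π_ℍ \ Π_𝒢 / Π′`.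
-/

namespace Literature.AnabelianGeometry.SemiGraphs

open CategoryTheory CategoryTheory.Limits CategoryTheory.PreGaloisCategory
open Literature.AnabelianGeometry.Anabelioids

universe v₁ u₁ u

namespace SemiGraphOfAnabelioids

variable {𝒢 𝒢' : SemiGraphOfAnabelioids.{v₁, u₁, u}}

/-- Heterogeneously equal components over propositionally equal edges are equal after transport.
[cite: MochizukiSemiAnbd2006, Def. 2.2(i) p.23] -/
private theorem eqRec_component_eq' (A : 𝒢.BObj) {e₁ e₂ : 𝒢.graph.Edge} (h : e₁ = e₂)
    (Q₂ : π₀Obj (A.T e₂)) (Q₁ : π₀Obj (A.T e₁)) (hQ : HEq Q₂ Q₁) :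
    (h ▸ Q₂ : π₀Obj (A.T e₁)) = Q₁ := by
  subst h
  exact eq_of_heq hQ

/-- The position clause read at the home edge as an inclusion of fibre-images (abc-iut-L6-d5's
`range_subset_of_branchClause`). [cite: MochizukiSemiAnbd2006, Def. 2.2(i) p.23] -/
private theorem range_subset_of_branchClause'' (A : 𝒢.BObj) {e₁ e₂ : 𝒢.graph.Edge} (h : e₁ = e₂)
    (F : 𝒢.E e₁ ⥤ FintypeCat.{v₁}) {X : 𝒢.E e₁} (g : X ⟶ A.T e₁) (Q : π₀Obj (A.T e₂))
    (f : (Q.1 : 𝒢.E e₂) ⟶ (𝒢.transportE h).obj X)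
    (hf : f ≫ (𝒢.transportE h).map g ≫ eqToHom (𝒢.transportE_obj_T A h) = Q.1.arrow) :
    Set.range (F.map (h ▸ Q : π₀Obj (A.T e₁)).1.arrow) ⊆ Set.range (F.map g) := by
  subst h
  change f ≫ g ≫ eqToHom rfl = Q.1.arrow at hf
  rw [eqToHom_refl, Category.comp_id] at hf
  change Set.range (F.map Q.1.arrow) ⊆ _
  rintro x ⟨q, rfl⟩
  refine ⟨F.map f q, ?_⟩
  have := congrArg (fun k => F.map k q) hf
  simp only [F.map_comp, FintypeCat.comp_apply] at this
  exact this

/-- **The sub-object of `A|_ℍ` attached to a preimage component `K`** (interface M2 of the (D3a)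
count): see the module docstring. [cite: MochizukiSemiAnbd2006, Cor. 2.7(i) p.30] -/
theorem exists_preimageComponentObject (φ : Hom 𝒢' 𝒢) (A : 𝒢.BObj)
    (cV : ∀ v' : 𝒢'.graph.Vertex, π₀Obj (A.S (φ.base.vertexMap v')))
    (cE : ∀ e' : 𝒢'.graph.Edge, π₀Obj (A.T (φ.base.edgeMap e')))
    (hVbij : Function.Bijective (fun v' : 𝒢'.graph.Vertex =>
      (⟨φ.base.vertexMap v', cV v'⟩ : Σ v, π₀Obj (A.S v))))
    (hEbij : Function.Bijective (fun e' : 𝒢'.graph.Edge =>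
      (⟨φ.base.edgeMap e', cE e'⟩ : Σ e, π₀Obj (A.T e))))
    (hbr : ∀ (b' : 𝒢'.graph.Branch) (v' : 𝒢'.graph.Vertex) (h' : 𝒢'.graph.abuts b' = some v'),
      ∃ f : ((cE (𝒢'.graph.edgeOf b')).1 : 𝒢.E (φ.base.edgeMap (𝒢'.graph.edgeOf b'))) ⟶
          (𝒢.transportE (φ.base.edgeOf_branchMap b')).obj
            ((𝒢.pull (φ.base.branchMap b') (φ.base.vertexMap v')
              (φ.base.abuts_branchMap b' v' h')).pullback.obj ((cV v').1 : 𝒢.V (φ.base.vertexMap v'))),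
        f ≫ (𝒢.transportE (φ.base.edgeOf_branchMap b')).map
              ((𝒢.pull _ _ (φ.base.abuts_branchMap b' v' h')).pullback.map (cV v').1.arrow ≫
                (A.ψ (φ.base.branchMap b') (φ.base.vertexMap v') (φ.base.abuts_branchMap b' v' h')).hom) ≫
            eqToHom (𝒢.transportE_obj_T A (φ.base.edgeOf_branchMap b')) =
          (cE (𝒢'.graph.edgeOf b')).1.arrow)
    (hprop : SemiGraph.IsProper φ.base) (H : 𝒢.graph.Subgraph) (hHg : H.toSemiGraph.IsGraph)
    (K : 𝒢'.graph.Subgraph) (hK : φ.IsPreimageComponent H K) :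
    ∃ (Z : (𝒢.restrict H).BObj) (m : Z ⟶ (𝒢.restrictFunctor H).obj A), Mono m ∧
      (∀ (w : H.toSemiGraph.Vertex) (Fw : 𝒢.V w.1 ⥤ FintypeCat.{v₁}) [FiberFunctor Fw]
          (y : Fw.obj (A.S w.1)),
        y ∈ Set.range (Fw.map (m.fS w)) ↔ ∃ P : π₀Obj (A.S w.1),
          (∃ w'' ∈ K.verts, (⟨φ.base.vertexMap w'', cV w''⟩ : Σ v, π₀Obj (A.S v)) = ⟨w.1, P⟩) ∧
            y ∈ Set.range (Fw.map P.1.arrow)) ∧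
      ∀ (e : H.toSemiGraph.Edge) (Fe : 𝒢.E e.1 ⥤ FintypeCat.{v₁}) [FiberFunctor Fe]
          (x : Fe.obj (A.T e.1)),
        x ∈ Set.range (Fe.map (m.fT e)) ↔ ∃ Q : π₀Obj (A.T e.1),
          (∃ e'' ∈ K.edges, (⟨φ.base.edgeMap e'', cE e''⟩ : Σ e, π₀Obj (A.T e)) = ⟨e.1, Q⟩) ∧
            x ∈ Set.range (Fe.map Q.1.arrow) := by
  classical
  -- fibre functors of the constituents of `𝒢`
  let FV : ∀ v : 𝒢.graph.Vertex, 𝒢.V v ⥤ FintypeCat.{v₁} := fun v =>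
    GaloisCategory.getFiberFunctor (𝒢.V v)
  let FE : ∀ e : 𝒢.graph.Edge, 𝒢.E e ⥤ FintypeCat.{v₁} := fun e =>
    GaloisCategory.getFiberFunctor (𝒢.E e)
  -- the component bijections and their inverses
  let σV : 𝒢'.graph.Vertex → Σ v, π₀Obj (A.S v) := fun v' => ⟨φ.base.vertexMap v', cV v'⟩
  let σE : 𝒢'.graph.Edge → Σ e, π₀Obj (A.T e) := fun e' => ⟨φ.base.edgeMap e', cE e'⟩
  let τV : (Σ v, π₀Obj (A.S v)) → 𝒢'.graph.Vertex := Function.surjInv hVbij.2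
  let τE : (Σ e, π₀Obj (A.T e)) → 𝒢'.graph.Edge := Function.surjInv hEbij.2
  have hστV : ∀ x, σV (τV x) = x := Function.surjInv_eq hVbij.2
  have hτσV : ∀ v', τV (σV v') = v' := Function.leftInverse_surjInv hVbij
  have hστE : ∀ x, σE (τE x) = x := Function.surjInv_eq hEbij.2
  have hτσE : ∀ e', τE (σE e') = e' := Function.leftInverse_surjInv hEbij
  -- the components over `v`, `e` selected by `K`
  let KV : ∀ v, Set (π₀Obj (A.S v)) := fun v => {P | τV ⟨v, P⟩ ∈ K.verts}
  let KE : ∀ e, Set (π₀Obj (A.T e)) := fun e => {Q | τE ⟨e, Q⟩ ∈ K.edges}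
  have hKV_iff : ∀ (v) (P : π₀Obj (A.S v)),
      P ∈ KV v ↔ ∃ w'' ∈ K.verts, σV w'' = ⟨v, P⟩ := fun v P =>
    ⟨fun h => ⟨_, h, hστV _⟩, fun ⟨w'', hw'', hσ⟩ => by
      change τV ⟨v, P⟩ ∈ K.verts; rw [← hσ, hτσV]; exact hw''⟩
  have hKE_iff : ∀ (e) (Q : π₀Obj (A.T e)),
      Q ∈ KE e ↔ ∃ e'' ∈ K.edges, σE e'' = ⟨e, Q⟩ := fun e Q =>
    ⟨fun h => ⟨_, h, hστE _⟩, fun ⟨e'', he'', hσ⟩ => by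
      change τE ⟨e, Q⟩ ∈ K.edges; rw [← hσ, hτσE]; exact he''⟩
  have hmem_iso : ∀ {e : 𝒢.graph.Edge} {X Y : 𝒢.E e} (g : X ⟶ Y) (ψ : Y ≅ A.T e)
      (x : (FE e).obj (A.T e)),
      x ∈ Set.range ((FE e).map (g ≫ ψ.hom)) ↔ (FE e).map ψ.inv x ∈ Set.range ((FE e).map g) := by
    intro e X Y g ψ x
    have hw : ∀ w, (FE e).map ψ.inv ((FE e).map ψ.hom w) = w := fun w =>
      FintypeCat.hom_inv_id_apply ((FE e).mapIso ψ) w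
    have hw' : ∀ w, (FE e).map ψ.hom ((FE e).map ψ.inv w) = w := fun w =>
      FintypeCat.inv_hom_id_apply ((FE e).mapIso ψ) w
    constructor
    · rintro ⟨z, rfl⟩
      exact ⟨z, by rw [Functor.map_comp, FintypeCat.comp_apply, hw]⟩
    · rintro ⟨z, hz⟩
      exact ⟨z, by rw [Functor.map_comp, FintypeCat.comp_apply, hz, hw']⟩
  /- KEY: along `b ∈ e` abutting to `v` with `e ∈ ℍ`, the components of `T_e` under `ψ_b(b^* P)`,
  `P` selected over `v`, are exactly the selected components of `T_e`. -/
  have key : ∀ (b : 𝒢.graph.Branch) (heH : 𝒢.graph.edgeOf b ∈ H.edges) (v : 𝒢.graph.Vertex)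
      (h : 𝒢.graph.abuts b = some v) (x : (FE (𝒢.graph.edgeOf b)).obj (A.T (𝒢.graph.edgeOf b))),
      (∃ P ∈ KV v, x ∈ Set.range ((FE _).map
          ((𝒢.pull b v h).pullback.map P.1.arrow ≫ (A.ψ b v h).hom))) ↔
        ∃ Q ∈ KE (𝒢.graph.edgeOf b), x ∈ Set.range ((FE _).map Q.1.arrow) := by
    intro b heH v h x
    -- the component of `x` in `T_e`, as an edge `e''` of `𝔾'` over `e`, with a branch over `b`
    obtain ⟨Q₀, hQ₀x⟩ := exists_component_mem_range (FE _) x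
    obtain ⟨e'', he''⟩ : ∃ e'', e'' = τE ⟨𝒢.graph.edgeOf b, Q₀⟩ := ⟨_, rfl⟩
    have hσe'' : σE e'' = ⟨𝒢.graph.edgeOf b, Q₀⟩ := by rw [he'']; exact hστE _
    have he''e : φ.base.edgeMap e'' = 𝒢.graph.edgeOf b := congrArg Sigma.fst hσe''
    have hQ₀heq : HEq (cE e'') Q₀ := (Sigma.mk.inj_iff.mp hσe'').2
    obtain ⟨b'', v'', hb''e, hb''b, hv''a, hv''v⟩ :=
      SemiGraph.exists_branch_preimage_abuts φ.base hprop e'' b he''e.symm v h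
    subst hb''b hv''v hb''e
    -- the branch clause at `b''`
    obtain ⟨f, hf⟩ := hbr b'' v'' hv''a
    have hsub := range_subset_of_branchClause'' A (φ.base.edgeOf_branchMap b'') (FE _)
      ((𝒢.pull _ _ (φ.base.abuts_branchMap b'' v'' hv''a)).pullback.map (cV v'').1.arrow ≫
        (A.ψ _ _ (φ.base.abuts_branchMap b'' v'' hv''a)).hom) (cE (𝒢'.graph.edgeOf b'')) f hf
    rw [eqRec_component_eq' A (φ.base.edgeOf_branchMap b'') (cE _) Q₀ hQ₀heq] at hsub
    -- `hsub : range (Q₀.arrow) ⊆ range (pull.map (cV v'').arrow ≫ ψ.hom)`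
    -- incidence closure of the component `K`: `v'' ∈ K ↔ e'' ∈ K`
    have hKve : v'' ∈ K.verts ↔ Q₀ ∈ KE (𝒢.graph.edgeOf (φ.base.branchMap b'')) := by
      change v'' ∈ K.verts ↔ τE ⟨_, Q₀⟩ ∈ K.edges
      rw [← he'']
      constructor
      · intro hv''
        exact hK.mem_edges_of_abuts hprop hHg hv'' hv''a (by rw [← φ.base.edgeOf_branchMap]; exact heH)
      · intro he''K
        exact hK.mem_verts_of_abuts he''K hv''a
    -- the fibre functor `b^* ⋙ F_e` of `𝒢_v`, to compare components of `S_v`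
    let F' : 𝒢.V (φ.base.vertexMap v'') ⥤ FintypeCat.{v₁} :=
      (𝒢.pull _ _ h).pullback ⋙ FE (𝒢.graph.edgeOf (φ.base.branchMap b''))
    haveI : FiberFunctor F' := fiberFunctor_comp_of_exact _ _
    have hrange : ∀ (P : π₀Obj (A.S (φ.base.vertexMap v''))) (y : (FE _).obj _),
        y ∈ Set.range ((FE (𝒢.graph.edgeOf (φ.base.branchMap b''))).map
          ((𝒢.pull _ _ h).pullback.map P.1.arrow ≫ (A.ψ _ _ h).hom)) →
        (FE _).map (A.ψ _ _ h).inv y ∈ Set.range (F'.map P.1.arrow) := fun P y hy =>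
      (hmem_iso _ _ y).mp hy
    constructor
    · rintro ⟨P, hP, hxP⟩
      have hx' := hsub hQ₀x
      have hPv : P = cV v'' :=
        component_eq_of_mem_range F' P (cV v'') (hrange P x hxP) (hrange (cV v'') x hx')
      subst hPv
      have hKv : v'' ∈ K.verts := by
        have : τV ⟨φ.base.vertexMap v'', cV v''⟩ = v'' := hτσV v''
        change τV ⟨_, cV v''⟩ ∈ K.verts at hP
        rwa [this] at hP
      exact ⟨Q₀, hKve.mp hKv, hQ₀x⟩
    · rintro ⟨Q, hQ, hxQ⟩
      have hQQ₀ : Q = Q₀ := component_eq_of_mem_range (FE _) Q Q₀ hxQ hQ₀x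
      subst hQQ₀
      have hKv : v'' ∈ K.verts := hKve.mpr hQ
      refine ⟨cV v'', ?_, hsub hxQ⟩
      change τV ⟨_, cV v''⟩ ∈ K.verts
      rwa [show τV ⟨φ.base.vertexMap v'', cV v''⟩ = v'' from hτσV v'']
  -- enumerate the selected components
  have hreV : ∀ v, ∃ n : ℕ, Nonempty (KV v ≃ Fin n) := fun v => by
    haveI : Finite (π₀Obj (A.S v)) := finite_connectedSubobject _
    exact Finite.exists_equiv_fin _
  have hreE : ∀ e, ∃ n : ℕ, Nonempty (KE e ≃ Fin n) := fun e => by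
    haveI : Finite (π₀Obj (A.T e)) := finite_connectedSubobject _
    exact Finite.exists_equiv_fin _
  choose nV εV using hreV
  choose nE εE using hreE
  let ιV : ∀ v, Fin (nV v) → π₀Obj (A.S v) := fun v i => ((εV v).some.symm i).1
  let ιE : ∀ e, Fin (nE e) → π₀Obj (A.T e) := fun e i => ((εE e).some.symm i).1
  have hιV_mem : ∀ v i, ιV v i ∈ KV v := fun v i => ((εV v).some.symm i).2
  have hιE_mem : ∀ e i, ιE e i ∈ KE e := fun e i => ((εE e).some.symm i).2
  have hιV_surj : ∀ v (P : π₀Obj (A.S v)), P ∈ KV v → ∃ i, ιV v i = P := fun v P hP =>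
    ⟨(εV v).some ⟨P, hP⟩, by simp [ιV]⟩
  have hιE_surj : ∀ e (Q : π₀Obj (A.T e)), Q ∈ KE e → ∃ i, ιE e i = Q := fun e Q hQ =>
    ⟨(εE e).some ⟨Q, hQ⟩, by simp [ιE]⟩
  have hιV_inj : ∀ v, Function.Injective (ιV v) := fun v i j hij =>
    (εV v).some.symm.injective (Subtype.ext hij)
  have hιE_inj : ∀ e, Function.Injective (ιE e) := fun e i j hij =>
    (εE e).some.symm.injective (Subtype.ext hij)
  let ZS : ∀ v, 𝒢.V v := fun v => ∐ fun i : Fin (nV v) => ((ιV v i).1 : 𝒢.V v)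
  let ZT : ∀ e, 𝒢.E e := fun e => ∐ fun i : Fin (nE e) => ((ιE e i).1 : 𝒢.E e)
  let mS : ∀ v, ZS v ⟶ A.S v := fun v => Sigma.desc fun i => (ιV v i).1.arrow
  let mT : ∀ e, ZT e ⟶ A.T e := fun e => Sigma.desc fun i => (ιE e i).1.arrow
  have hrangeS : ∀ (v) (F : 𝒢.V v ⥤ FintypeCat.{v₁}) [FiberFunctor F] (y : F.obj (A.S v)),
      y ∈ Set.range (F.map (mS v)) ↔ ∃ P ∈ KV v, y ∈ Set.range (F.map P.1.arrow) := by
    intro v F _ y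
    change y ∈ Set.range (F.map (Sigma.desc fun i => (ιV v i).1.arrow)) ↔ _
    rw [range_map_sigmaDesc, Set.mem_iUnion]
    exact ⟨fun ⟨i, hi⟩ => ⟨ιV v i, hιV_mem v i, hi⟩, fun ⟨P, hP, hy⟩ => by
      obtain ⟨i, rfl⟩ := hιV_surj v P hP; exact ⟨i, hy⟩⟩
  have hrangeT : ∀ (e) (F : 𝒢.E e ⥤ FintypeCat.{v₁}) [FiberFunctor F] (y : F.obj (A.T e)),
      y ∈ Set.range (F.map (mT e)) ↔ ∃ Q ∈ KE e, y ∈ Set.range (F.map Q.1.arrow) := by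
    intro e F _ y
    change y ∈ Set.range (F.map (Sigma.desc fun i => (ιE e i).1.arrow)) ↔ _
    rw [range_map_sigmaDesc, Set.mem_iUnion]
    exact ⟨fun ⟨i, hi⟩ => ⟨ιE e i, hιE_mem e i, hi⟩, fun ⟨Q, hQ, hy⟩ => by
      obtain ⟨i, rfl⟩ := hιE_surj e Q hQ; exact ⟨i, hy⟩⟩
  haveI hmS : ∀ v, Mono (mS v) := fun v =>
    mono_sigmaDesc_of_pairwise_disjoint (FV v) _ fun i j hij =>
      Set.disjoint_left.mpr fun y hyi hyj =>
        hij (hιV_inj v (component_eq_of_mem_range (FV v) _ _ hyi hyj))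
  haveI hmT : ∀ e, Mono (mT e) := fun e =>
    mono_sigmaDesc_of_pairwise_disjoint (FE e) _ fun i j hij =>
      Set.disjoint_left.mpr fun y hyi hyj =>
        hij (hιE_inj e (component_eq_of_mem_range (FE e) _ _ hyi hyj))
  -- the gluing isomorphisms of `Z`, along the branches of `ℍ`
  have hψrange : ∀ (b : 𝒢.graph.Branch) (heH : 𝒢.graph.edgeOf b ∈ H.edges) (v : 𝒢.graph.Vertex)
      (h : 𝒢.graph.abuts b = some v),
      Set.range ((FE _).map ((𝒢.pull b v h).pullback.map (mS v) ≫ (A.ψ b v h).hom)) =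
        Set.range ((FE _).map (mT (𝒢.graph.edgeOf b))) := by
    intro b heH v h
    let F' : 𝒢.V v ⥤ FintypeCat.{v₁} := (𝒢.pull b v h).pullback ⋙ FE (𝒢.graph.edgeOf b)
    haveI : FiberFunctor F' := fiberFunctor_comp_of_exact _ _
    ext x
    rw [hmem_iso, hrangeT]
    have h1 : (FE _).map (A.ψ b v h).inv x ∈
        Set.range ((FE _).map ((𝒢.pull b v h).pullback.map (mS v))) ↔
          ∃ P ∈ KV v, (FE _).map (A.ψ b v h).inv x ∈ Set.range (F'.map P.1.arrow) :=
      hrangeS v F' _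
    refine h1.trans ?_
    rw [← key b heH v h x]
    refine exists_congr fun P => and_congr_right fun _ => ?_
    exact (hmem_iso ((𝒢.pull b v h).pullback.map P.1.arrow) (A.ψ b v h) x).symm
  have hψex : ∀ (b : (𝒢.restrict H).graph.Branch) (w : (𝒢.restrict H).graph.Vertex)
      (h : (𝒢.restrict H).graph.abuts b = some w),
      ∃ ε : (𝒢.pull b.1 w.1 (H.ι.abuts_branchMap b w h)).pullback.obj (ZS w.1) ≅
          ZT (𝒢.graph.edgeOf b.1),
        ε.hom ≫ mT _ = (𝒢.pull b.1 w.1 (H.ι.abuts_branchMap b w h)).pullback.map (mS w.1) ≫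
          (A.ψ b.1 w.1 (H.ι.abuts_branchMap b w h)).hom :=
    fun b w h => exists_iso_of_range_eq (FE _) _ _ (hψrange b.1 b.2 w.1 (H.ι.abuts_branchMap b w h))
  choose Zψ hZψ using hψex
  let Z : (𝒢.restrict H).BObj := { S := fun w => ZS w.1, T := fun e => ZT e.1, ψ := Zψ }
  let m : Z ⟶ (𝒢.restrictFunctor H).obj A :=
    { fS := fun w => mS w.1, fT := fun e => mT e.1, comm := fun b w h => (hZψ b w h).symm }
  haveI : Mono m := mono_of_components m (fun w => hmS w.1) fun e => hmT e.1
  refine ⟨Z, m, inferInstance, fun w Fw _ y => ?_, fun e Fe _ x => ?_⟩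
  · change y ∈ Set.range (Fw.map (mS w.1)) ↔ _
    rw [hrangeS w.1 Fw y]
    exact exists_congr fun P => and_congr_left fun _ => hKV_iff w.1 P
  · change x ∈ Set.range (Fe.map (mT e.1)) ↔ _
    rw [hrangeT e.1 Fe x]
    exact exists_congr fun Q => and_congr_left fun _ => hKE_iff e.1 Q

end SemiGraphOfAnabelioids

end Literature.AnabelianGeometry.SemiGraphs
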